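import Summits.QuantumAdvantage.QuantumAdvantage.Theorems.CouplingDialHidden

/-!
# CouplingDial (part D, unipotency dial) — `N_k`: inversion depth of the coupling; `T ⟺ N_1`, `T ⟹ N_{log n+1}`, `N_{n/6}` THEOREM, `closes_nil`

Tree twin of node «CouplingDial» rev 2 §10 (cut verbatim).  `ustep` / `uiter` / `Unipotent L j` (`(L ⊕ 𝟙)^j = 0`), `NilSlice k` / `NilRung k`
(`N_k`), `LogNilRung` (`W′`), `ConstNilRung`, `NilLift` (`R′ := W′ → T`); `unipotent_one_iff`, `nilRung_one_iff`, `rungANonuniform_iff_nilRung_one`,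
`nilRung_mono`, `logNilRung_of_rungANonuniform`, `hidden_of_nilRung`; the level-map nilpotency of the HintDial automaton (`EE_level`,
`uiter_QQ_vanish`, `uiter_trQQ_vanish`, `unipotent_hinst`), `nilRung_of_le`, `nilRung_sixth : NilRung (fun n => n / 6)`;
`rungANonuniform_iff_nilPieces : RungANonuniform ↔ LogNilRung ∧ NilLift`, `closes_nil`, `dial_summary_rev2`.
-/

set_option linter.dupNamespace false

noncomputable section

namespace Summit.QuantumAdvantage.QuantumAdvantage.Theorems.CouplingDial

open Finset
open Literature.Computability.Complexity
open Literature.Computability.QuantumComplexity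
open Literature.Computability.MetaComplexity
open _root_.Computability (encodeNat)
open Summit.QuantumAdvantage.QuantumAdvantage.Theorems.HintDial
open Summit.QuantumAdvantage.QuantumAdvantage.Theorems.HintDial.Automaton
open Summit.QuantumAdvantage.QuantumAdvantage.Theorems.GapDial.Automaton (blockDiag blockDiag_left blockDiag_right
  mv_blockDiag bd_zero_left EE bxor_append)
open Summit.QuantumAdvantage.QuantumAdvantage.Theorems.FlatDial (clen length_encode_eq_clen clen_injective clen_lt_clen le_clen)
open Summit.QuantumAdvantage.QuantumAdvantage.Theses.AnfPresentation (RungANonuniform RungA LiftA AnfEquiv NearExactIsExact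
  SignedExactSliceIsLift)
open CubicForm (bit)
open DerivativeWalsh (W)
open BuzetChailloux (bxor zeroVec)

/-! ## §10 ★★ THE REFINED DIAL THAT SURVIVES: UNIPOTENCY INDEX of the coupling (how deep is `L⁻¹`?)

Since `U_0` is a theorem, co-rank is the wrong dial: its permissive end lets the instance carry an arbitrarily deep inverse.  The honest
refinement measures the DEPTH of `L⁻¹`: restrict to UNIPOTENT couplings `L = 𝟙 ⊕ N` with `(L ⊕ 𝟙)^{k(n)} = N^{k(n)} = 0`, so that
`L⁻¹ = Σ_{j<k} N^j` is an iterated product of depth `k`.  `N_k := NilRung k`.  `N_1` = the identity slice (`T ⟺ N_1`, kernel);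
`T ⟹ N_k` for every `k ≥ 1` (sub-promise); `N_{n/6}` is a THEOREM (the §9 planting is unipotent of index `m+1 = n/6`); the pieces of
the revised split are `W′ := LogNilRung = N_{log₂ n + 1}` [WEAKER · NECESSARY · OPEN] and `R′ := NilLift := W′ → T` [residual].
DEGREE LAW (hand, NODE-g12 §7): a planting through `L⁻¹` of index `k` produces labels of `𝔽₂`-degree `≤ k` in `w` — for `k = polylog`
Razborov–Smolensky is blind, so `W′` by the linear-algebra route needs an explicit LOW-DEGREE function outside `AC⁰[⊕]` (open); the
Forrelation route to `W′` is `T` itself or new.  Proved/open boundary of this dial: index `2^{(log n)^δ}` (plantable, padding) vs `polylog`. -/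

section Nil

variable {k k₁ k₂ : ℕ} {m : ℕ}

/-- one step of `L ⊕ 𝟙`: `v ↦ L v ⊕ v`. -/
def ustep (L : Fin k → Fin k → Bool) (v : Fin k → Bool) : Fin k → Bool := bxor (mv L v) v

/-- `(L ⊕ 𝟙)^j v`. -/
def uiter (L : Fin k → Fin k → Bool) : ℕ → (Fin k → Bool) → (Fin k → Bool)
  | 0, v => v
  | j + 1, v => ustep L (uiter L j v)

/-- ★ `L` is UNIPOTENT OF INDEX `≤ j`: `(L ⊕ 𝟙)^j = 0` (so `L = 𝟙 ⊕ N`, `N` nilpotent, `L⁻¹ = Σ_{i<j} N^i`). -/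
def Unipotent (L : Fin k → Fin k → Bool) (j : ℕ) : Prop := ∀ v, uiter L j v = zeroVec

/-- CouplingDialNil helper `ustep_zeroVec` (decomp-qadv land package; see the module docstring). -/
theorem ustep_zeroVec (L : Fin k → Fin k → Bool) : ustep L zeroVec = zeroVec := by
  rw [ustep, mv_zeroVec, BuzetChailloux.bxor_self]

/-- CouplingDialNil helper `uiter_zeroVec` (decomp-qadv land package; see the module docstring). -/
theorem uiter_zeroVec (L : Fin k → Fin k → Bool) (j : ℕ) : uiter L j zeroVec = zeroVec := by
  induction j with
  | zero => rfl
  | succ j ih => show ustep L (uiter L j zeroVec) = _; rw [ih, ustep_zeroVec]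

/-- CouplingDialNil helper `uiter_add` (decomp-qadv land package; see the module docstring). -/
theorem uiter_add (L : Fin k → Fin k → Bool) (i j : ℕ) (v : Fin k → Bool) : uiter L (i + j) v = uiter L i (uiter L j v) := by
  induction i with
  | zero => rw [Nat.zero_add]; rfl
  | succ i ih => rw [Nat.succ_add]; show ustep L (uiter L (i + j) v) = ustep L (uiter L i (uiter L j v)); rw [ih]

/-- CouplingDialNil helper `Unipotent.mono` (decomp-qadv land package; see the module docstring). -/
theorem Unipotent.mono {L : Fin k → Fin k → Bool} {j j' : ℕ} (h : Unipotent L j) (hj : j ≤ j') : Unipotent L j' := fun v => by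
  obtain ⟨i, rfl⟩ := Nat.exists_eq_add_of_le hj
  rw [Nat.add_comm, uiter_add, h v, uiter_zeroVec]

/-- unipotent ⟹ invertible (`ker L = 0`). -/
theorem kerCard_le_one_of_unipotent (I : CTriple) {j : ℕ} (h : Unipotent I.L j) : I.kerCard ≤ 1 := by
  have key : ∀ y, mv I.L y = zeroVec → y = zeroVec := fun y hy => by
    have hs : ustep I.L y = y := by rw [ustep, hy, BuzetChailloux.zeroVec_bxor]
    have hi : ∀ i, uiter I.L i y = y := fun i => by
      induction i with
      | zero => rfl
      | succ i ih => show ustep I.L (uiter I.L i y) = y; rw [ih, hs]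
    rw [← hi j]; exact h y
  exact Fintype.card_le_one_iff_subsingleton.mpr ⟨fun a b => Subtype.ext ((key a.1 a.2).trans (key b.1 b.2).symm)⟩

/-- index `1` ⟺ the identity coupling. -/
theorem unipotent_one_iff (L : Fin k → Fin k → Bool) : Unipotent L 1 ↔ L = dM := by
  constructor
  · intro h
    funext a b
    have hv : xor (bd (L a) (sgl b)) (sgl b a) = false := congr_fun (h (sgl b)) a
    rw [bd_sgl_right] at hv
    have hLs : L a b = sgl b a := by revert hv; cases L a b <;> cases sgl b a <;> simp
    have e1 : sgl b a = decide (b = a) := by simp only [sgl]; rw [decide_eq_decide]; exact eq_comm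
    show L a b = decide (b = a)
    rw [hLs, e1]
  · rintro rfl v
    show bxor (mv dM v) v = zeroVec
    rw [mv_dM, BuzetChailloux.bxor_self]

/-- ★ THE INDEX-`k` UNIPOTENT COUPLED SLICE and its rung `N_k`. -/
def NilSlice (k : ℕ → ℕ) : PromiseProblem :=
  ⟨CTriple.encode '' {I | Even I.n ∧ Unipotent I.L (k I.n) ∧ I.cvalue = 1},
    CTriple.encode '' {I | Even I.n ∧ Unipotent I.L (k I.n) ∧ I.cvalue = -1}⟩

/-- ★ `N_k`: exact signed cubic Forrelation through a unipotent coupling of index `≤ k(n)` is not in promise-`AC⁰[⊕]`. -/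
def NilRung (k : ℕ → ℕ) : Prop := NilSlice k ∉ promiseLift (AC0Mod 2)

/-- ★ `W′` = `N_{log₂ n + 1}`: LOGARITHMIC INVERSION DEPTH.  [WEAKER than `T`, NECESSARY, OPEN] -/
def LogNilRung : Prop := NilRung fun n => Nat.log 2 n + 1

/-- `N_{c+1}`, constant inversion depth (`c = 0` is the identity slice; expected `⟺ T` for every constant `c` by `AC⁰[⊕]`-inversion — not claimed). -/
def ConstNilRung (c : ℕ) : Prop := NilRung fun _ => c + 1

/-- ★ `R′` = THE RESIDUAL of the refined dial: logarithmic inversion depth lifts to depth one. -/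
def NilLift : Prop := LogNilRung → RungANonuniform

/-- CouplingDialNil helper `nilRung_mono` (decomp-qadv land package; see the module docstring). -/
theorem nilRung_mono {k₁' k₂' : ℕ → ℕ} (h : ∀ n, k₁' n ≤ k₂' n) : NilRung k₁' → NilRung k₂' := by
  rintro h₁ ⟨D, hD, hy, hn⟩
  refine h₁ ⟨D, hD, fun x hx => hy ?_, fun x hx => hn ?_⟩
  · obtain ⟨I, ⟨he, hu, hv⟩, rfl⟩ := hx; exact ⟨I, ⟨he, hu.mono (h I.n), hv⟩, rfl⟩
  · obtain ⟨I, ⟨he, hu, hv⟩, rfl⟩ := hx; exact ⟨I, ⟨he, hu.mono (h I.n), hv⟩, rfl⟩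

/-- CouplingDialNil helper `nilSlice_one_eq` (decomp-qadv land package; see the module docstring). -/
theorem nilSlice_one_eq : NilSlice (fun _ => 1) = IdCoupledSlice := by
  unfold NilSlice IdCoupledSlice
  simp_rw [unipotent_one_iff]

/-- ★ `N_1 ⟺ T′ ⟺ T` (kernel). -/
theorem nilRung_one_iff : NilRung (fun _ => 1) ↔ IdCouplingRung := by
  rw [NilRung, nilSlice_one_eq]; rfl

/-- CouplingDialNil helper `rungANonuniform_iff_nilRung_one` (decomp-qadv land package; see the module docstring). -/
theorem rungANonuniform_iff_nilRung_one : RungANonuniform ↔ NilRung (fun _ => 1) :=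
  rungANonuniform_iff_idCouplingRung.trans nilRung_one_iff.symm

/-- ★ NECESSITY: `T ⟹ N_k` for every index schedule `k ≥ 1`. -/
theorem nilRung_of_rungANonuniform {k' : ℕ → ℕ} (hk : ∀ n, 1 ≤ k' n) : RungANonuniform → NilRung k' :=
  fun h => nilRung_mono hk (rungANonuniform_iff_nilRung_one.mp h)

/-- CouplingDialNil helper `logNilRung_of_rungANonuniform` (decomp-qadv land package; see the module docstring). -/
theorem logNilRung_of_rungANonuniform : RungANonuniform → LogNilRung :=
  nilRung_of_rungANonuniform fun _ => Nat.le_add_left 1 _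

/-- CouplingDialNil helper `constNilRung_of_rungANonuniform` (decomp-qadv land package; see the module docstring). -/
theorem constNilRung_of_rungANonuniform (c : ℕ) : RungANonuniform → ConstNilRung c :=
  nilRung_of_rungANonuniform fun _ => Nat.le_add_left 1 _

/-- placement: every `N_k` implies the (proved) `U_0` (unipotent ⟹ invertible). -/
theorem hidden_of_nilRung (k' : ℕ → ℕ) : NilRung k' → HiddenCouplingRung := by
  rintro h ⟨D, hD, hy, hn⟩
  refine h ⟨D, hD, fun x hx => hy ?_, fun x hx => hn ?_⟩
  · obtain ⟨I, ⟨he, hu, hv⟩, rfl⟩ := hx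
    exact ⟨I, ⟨he, (kerCard_le_one_of_unipotent I hu).trans (le_of_eq (pow_zero 2).symm), hv⟩, rfl⟩
  · obtain ⟨I, ⟨he, hu, hv⟩, rfl⟩ := hx
    exact ⟨I, ⟨he, (kerCard_le_one_of_unipotent I hu).trans (le_of_eq (pow_zero 2).symm), hv⟩, rfl⟩

/-! ### The §9 planting is unipotent of index `m + 1 = n/6`: the proved end of the refined dial -/

/-- CouplingDialNil helper `ustep_eq_mv` (decomp-qadv land package; see the module docstring). -/
theorem ustep_eq_mv {M N : Fin k → Fin k → Bool} (h : ∀ a, M a = bxor (sgl a) (N a)) (v : Fin k → Bool) : ustep M v = mv N v := by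
  funext a
  show xor (bd (M a) v) (v a) = bd (N a) v
  rw [h a, Summit.QuantumAdvantage.QuantumAdvantage.Theorems.FlatDial.bd_bxor_left, bd_sgl_left]
  cases v a <;> cases bd (N a) v <;> rfl

/-- `Q_w = 𝟙 ⊕ E_w` row-wise, -/
theorem QQ_row (w : Fin m → Bool) (a : Fin (kk m)) : QQ w a = bxor (sgl a) (EE w a) := by
  funext b
  show qEnt w (nd.symm a) (nd.symm b) = xor (decide (b = a)) (edgeB w (nd.symm a) (nd.symm b))
  rw [qEnt]
  congr 1
  rw [decide_eq_decide]
  exact ⟨fun h => (nd.symm.injective h).symm, fun h => h ▸ rfl⟩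

/-- and `Q_wᵀ = 𝟙 ⊕ E_wᵀ`. -/
theorem trQQ_row (w : Fin m → Bool) (a : Fin (kk m)) : trM (QQ w) a = bxor (sgl a) (trM (EE w) a) := by
  funext b
  show qEnt w (nd.symm b) (nd.symm a) = xor (decide (b = a)) (edgeB w (nd.symm b) (nd.symm a))
  rw [qEnt]
  congr 1
  rw [decide_eq_decide]
  exact ⟨fun h => nd.symm.injective h, fun h => h ▸ rfl⟩

/-- edges of the layered automaton go DOWN one level. -/
theorem EE_level (w : Fin m → Bool) {a b : Fin (kk m)} (h : EE w a b = true) : ((nd.symm b).1 : ℕ) + 1 = (nd.symm a).1 := by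
  unfold EE edgeB at h
  rw [Bool.and_eq_true, decide_eq_true_eq] at h
  exact h.1

/-- `E_w^j v` vanishes at levels `< j`. -/
theorem uiter_QQ_vanish (w : Fin m → Bool) (y : Fin (kk m) → Bool) :
    ∀ (j : ℕ) (a : Fin (kk m)), ((nd.symm a).1 : ℕ) < j → uiter (QQ w) j y a = false := by
  intro j
  induction j with
  | zero => intro a h; exact absurd h (Nat.not_lt_zero _)
  | succ j ih =>
    intro a ha
    show ustep (QQ w) (uiter (QQ w) j y) a = false
    rw [ustep_eq_mv (QQ_row w)]
    show bd (EE w a) (uiter (QQ w) j y) = false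
    have hempty : (univ.filter fun b => EE w a b && uiter (QQ w) j y b) = ∅ :=
      Finset.filter_eq_empty_iff.mpr fun b _ hb => by
        rw [Bool.and_eq_true] at hb
        have hl := EE_level w hb.1
        rw [ih b (by omega)] at hb
        exact Bool.false_ne_true hb.2
    rw [bd, hempty, Finset.card_empty]
    simp

/-- `(E_wᵀ)^j v` vanishes at levels `> m - j`. -/
theorem uiter_trQQ_vanish (w : Fin m → Bool) (y : Fin (kk m) → Bool) :
    ∀ (j : ℕ) (a : Fin (kk m)), m < ((nd.symm a).1 : ℕ) + j → uiter (trM (QQ w)) j y a = false := by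
  intro j
  induction j with
  | zero => intro a h; exact absurd h (by have := (nd.symm a).1.isLt; omega)
  | succ j ih =>
    intro a ha
    show ustep (trM (QQ w)) (uiter (trM (QQ w)) j y) a = false
    rw [ustep_eq_mv (trQQ_row w)]
    show bd (trM (EE w) a) (uiter (trM (QQ w)) j y) = false
    have hempty : (univ.filter fun b => trM (EE w) a b && uiter (trM (QQ w)) j y b) = ∅ :=
      Finset.filter_eq_empty_iff.mpr fun b _ hb => by
        rw [Bool.and_eq_true] at hb
        have hl := EE_level w (show EE w b a = true from hb.1)
        rw [ih b (by omega)] at hb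
        exact Bool.false_ne_true hb.2
    rw [bd, hempty, Finset.card_empty]
    simp

/-- CouplingDialNil helper `ustep_blockDiag` (decomp-qadv land package; see the module docstring). -/
theorem ustep_blockDiag (A : Fin k₁ → Fin k₁ → Bool) (B : Fin k₂ → Fin k₂ → Bool) (y₁ : Fin k₁ → Bool) (y₂ : Fin k₂ → Bool) :
    ustep (blockDiag A B) (Fin.append y₁ y₂) = Fin.append (ustep A y₁) (ustep B y₂) := by
  rw [ustep, mv_blockDiag, bxor_append]; rfl

/-- CouplingDialNil helper `uiter_blockDiag` (decomp-qadv land package; see the module docstring). -/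
theorem uiter_blockDiag (A : Fin k₁ → Fin k₁ → Bool) (B : Fin k₂ → Fin k₂ → Bool) (j : ℕ) :
    ∀ (y₁ : Fin k₁ → Bool) (y₂ : Fin k₂ → Bool),
      uiter (blockDiag A B) j (Fin.append y₁ y₂) = Fin.append (uiter A j y₁) (uiter B j y₂) := by
  induction j with
  | zero => intro y₁ y₂; rfl
  | succ j ih =>
    intro y₁ y₂
    show ustep _ (uiter _ j _) = Fin.append (ustep A (uiter A j y₁)) (ustep B (uiter B j y₂))
    rw [ih, ustep_blockDiag]

/-- ★ THE PLANTED COUPLING `Q_w ⊕ Q_wᵀ` IS UNIPOTENT OF INDEX `m + 1` (`= n/6`). -/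
theorem unipotent_hinst (w : Fin m → Bool) : Unipotent (hinst w).L (m + 1) := by
  intro y
  obtain ⟨⟨y₁, y₂⟩, rfl⟩ := (Fin.appendEquiv _ _).surjective y
  show uiter (blockDiag (QQ w) (trM (QQ w))) (m + 1) (Fin.append y₁ y₂) = zeroVec
  rw [uiter_blockDiag]
  funext i
  refine Fin.addCases (fun a => ?_) (fun b => ?_) i
  · rw [Fin.append_left]; exact uiter_QQ_vanish w y₁ (m + 1) a (nd.symm a).1.isLt
  · rw [Fin.append_right]; exact uiter_trQQ_vanish w y₂ (m + 1) b (by omega)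

/-- CouplingDialNil helper `hinst_mem_nil_yes` (decomp-qadv land package; see the module docstring). -/
theorem hinst_mem_nil_yes (w : Fin m → Bool) {k' : ℕ → ℕ} (hk : m + 1 ≤ k' (kk m + kk m)) (h3 : GateFn.numOnes w % 3 = 0) :
    (hinst w).encode ∈ (NilSlice k').yes := by
  refine ⟨hinst w, ⟨⟨kk m, rfl⟩, (unipotent_hinst w).mono hk, ?_⟩, rfl⟩
  rw [cvalue_hinst, qv_zeroVec_b₀, decide_eq_true h3]; norm_num [signOf]

/-- CouplingDialNil helper `hinst_mem_nil_no` (decomp-qadv land package; see the module docstring). -/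
theorem hinst_mem_nil_no (w : Fin m → Bool) {k' : ℕ → ℕ} (hk : m + 1 ≤ k' (kk m + kk m)) (h3 : ¬ GateFn.numOnes w % 3 = 0) :
    (hinst w).encode ∈ (NilSlice k').no := by
  refine ⟨hinst w, ⟨⟨kk m, rfl⟩, (unipotent_hinst w).mono hk, ?_⟩, rfl⟩
  rw [cvalue_hinst, qv_zeroVec_b₀, decide_eq_false h3]; norm_num [signOf]

/-- ★★ THE PROVED END OF THE REFINED DIAL: `N_k` holds whenever `k(6m+6) ≥ m+1`. -/
theorem nilRung_of_le (k' : ℕ → ℕ) (hk : ∀ m, m + 1 ≤ k' (kk m + kk m)) : NilRung k' :=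
  not_promiseLift_AC0Mod_of_proj Nat.prime_two Nat.prime_three (by decide) _ (fun m w => (hinst w).encode)
    (fun m => isProj_encode_hinst) (tPoly.comp (nPoly 0)) (fun m w => length_encode_hinst_le w)
    (fun m w h => hinst_mem_nil_yes w (hk m) h) (fun m w h => hinst_mem_nil_no w (hk m) h)

/-- ★★ `N_{n/6}` IS A THEOREM (inversion depth linear in the arity). -/
theorem nilRung_sixth : NilRung (fun n => n / 6) :=
  nilRung_of_le _ fun m => by show m + 1 ≤ ((m + 1) * 3 + (m + 1) * 3) / 6; omega

/-! ### The revised pieces and `closes` -/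

/-- CouplingDialNil helper `rungANonuniform_of_nilPieces` (decomp-qadv land package; see the module docstring). -/
theorem rungANonuniform_of_nilPieces (w : LogNilRung) (ℓ : NilLift) : RungANonuniform := ℓ w

/-- CouplingDialNil helper `nilPieces_of_rungANonuniform` (decomp-qadv land package; see the module docstring). -/
theorem nilPieces_of_rungANonuniform (h : RungANonuniform) : LogNilRung ∧ NilLift :=
  ⟨logNilRung_of_rungANonuniform h, fun _ => h⟩

/-- ★ REVISED NODE EQUATION: `T ⟺ W′ ∧ R′`. -/
theorem rungANonuniform_iff_nilPieces : RungANonuniform ↔ LogNilRung ∧ NilLift :=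
  ⟨nilPieces_of_rungANonuniform, fun h => rungANonuniform_of_nilPieces h.1 h.2⟩

/-- ★★★ `closes` BY NAME for the refined dial: `W′ = LogNilRung` [WEAKER · NECESSARY · OPEN], `R′ = NilLift` [residual ≡ T mod W′]. -/
theorem closes_nil (h₁ : NearExactIsExact) (h₂ : SignedExactSliceIsLift) (w : LogNilRung) (ℓ : NilLift) (p₂ : LiftA)
    (hE : AnfEquiv) : QuantumAdvantage :=
  Summit.QuantumAdvantage.QuantumAdvantage.Theses.AnfPresentation.closes h₁ h₂
    (rungA_of_rungANonuniform (rungANonuniform_of_nilPieces w ℓ)) p₂ hE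

/-- ★ SUMMARY (rev 2, kernel-checked): co-rank dial DECIDED (`U_0` and every `U_d` theorems, `CouplingLift ⟺ T`); unipotency dial:
`T ⟺ N_1`, `T ⟹ W′ = N_{log n+1}`, `T ⟹ N_{c+1}`, `N_{n/6}` THEOREM, every `N_k ⟹ U_0`, `T ⟺ W′ ∧ R′`. -/
theorem dial_summary_rev2 :
    HiddenCouplingRung ∧ (∀ d, CouplingRung d) ∧ (CouplingLift ↔ RungANonuniform) ∧
    (RungANonuniform ↔ NilRung fun _ => 1) ∧ (RungANonuniform → LogNilRung) ∧ (∀ c, RungANonuniform → ConstNilRung c) ∧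
    NilRung (fun n => n / 6) ∧ (∀ k', NilRung k' → HiddenCouplingRung) ∧ (RungANonuniform ↔ LogNilRung ∧ NilLift) :=
  ⟨hiddenCouplingRung, couplingRung_all, couplingLift_iff_rungANonuniform, rungANonuniform_iff_nilRung_one,
    logNilRung_of_rungANonuniform, constNilRung_of_rungANonuniform, nilRung_sixth, hidden_of_nilRung,
    rungANonuniform_iff_nilPieces⟩

end Nil

end Summit.QuantumAdvantage.QuantumAdvantage.Theorems.CouplingDial

end
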